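import Literature.MathematicalPhysics.QuantumFieldTheory.Federbush1986.PhaseCellIVThmA3Sphere
import Literature.MathematicalPhysics.QuantumFieldTheory.Federbush1986.PhaseCellIVGeomConstruction4
import Literature.Analysis.Calculus.SubmanifoldTubularRetraction

/-!
# `Federbush1986.PhaseCellIVThmA34Submanifold` — [Federbush1988PhaseCellIV] Appendix A, **Theorems A.3 and A.4** (decls
# of record `PhaseCellIVAppA.ThmA3ContCap` / `ThmA4ContCap`), and Theorems A.2 / A.1 (small clause) / Geometric
# Construction 4, for EVERY COMPACT `C^∞` SUBMANIFOLD `M ⊂ R^t` — the normal projection `Pr_M` CONSTRUCTED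

statement-level skeleton of published theorems with citation tags; proofs where landed; nothing here is a claim about the Yang–Mills mass gap

CITATION HEADER.  P. Federbush, *A phase cell approach to Yang–Mills theory. IV. The choice of variables*, Commun. Math.
Phys. **114** (1988) 317–343 [Federbush1988PhaseCellIV], Appendix A: Theorem A.3 (A.25)–(A.26) and its proof (A.27)–(A.31)
p. 342, Theorem A.4 (A.34)–(A.36) p. 343, Theorem A.2 (A.18)–(A.19) p. 341, Theorem A.1 p. 339, Geometric Construction 4
p. 338; p. 339 «Caution».  Cell `lit-balaban`, Phase-2 proof seat **p04 gen 8**; SKELETON rows **F4.ThmA.3**, **F4.ThmA.4**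
(decls of record `ThmA3ContCap` / `ThmA4ContCap`, p251889; fold owner r19), F4.ThmA.2 (`ThmA2Emb`, r19 p263972), F4.ThmA.1
(small clause `ThmA1EmbAt`, r19 p265091), F4.Def§11 (Construction 4, `GeomConstruction4`, r19 p266275).

WHAT IS PRINTED (p. 342, after (A.31)): «`f^s_ε(x) = Pr_M(f^{s′}_ε(x))` (A.31), where `Pr_M` is the projection onto `M`, using
the normal bundle to `M`, and defined in a neighborhood of `M`» — for «`M`, a compact differentiable manifold (without boundary)
equipped with a metric» (p. 342), embedded: «We now embed `M` in some Euclidean space `R^t`» (p. 342, part B).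

WHAT THIS FILE PROVES.  The tree proved Theorems A.3/A.4 (`Retract.thmA3ContCap_of_retract` p261759,
`Retract.thmA4ContCap_of_retract` p262634) and A.2 / A.1-small / Construction 4 (`thmA2Emb_of_retract` p263972,
`thmA1EmbAt_of_retract(_of_large)` p265091/p265328, `geomConstruction4_of_retract` p266275) for every target `M ⊆ R^t`
admitting a uniform smooth (resp. Lipschitz) neighbourhood retraction — the output of the tubular-neighbourhood theorem,
carried as hypotheses.  The general-calculus files `Literature.Analysis.Calculus.SubmanifoldFootPoint` /
`SubmanifoldNearestPoint` / `SubmanifoldTubularRetraction` (this seat) PROVE that theorem for every compact `C^∞` submanifold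
([LeeSmoothManifolds2013] Thm. 6.24 / Prop. 6.25 / Problem 6-5: the nearest-point retraction is `C^∞` on a tube, with bounded
derivatives and Lipschitz), in the tree's vocabulary of record `Literature.AlgebraicGeometry.RealAlgebraic.IsSubmanifoldOfDim`
(local `C^∞` parametrisations of `S ⊆ (Fin t → ℝ)` with `C^∞` left inverses; Lee Thm. 5.8 / Prop. 5.16), read for
`M ⊆ EuclideanSpace ℝ (Fin t)` through the coordinate identification `EuclideanSpace.equiv (Fin t) ℝ`.  Hence, with NO
retraction hypothesis, for every `M ⊆ EuclideanSpace ℝ (Fin t)` that is compact and a `d`-dimensional `C^∞` submanifold: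

* **`thmA3ContCap_of_submanifold : ThmA3ContCap n t M`** (row F4.ThmA.3, decl of record) and
  **`thmA4ContCap_of_submanifold : ThmA4ContCap n t M`** (row F4.ThmA.4, decl of record) — print's generality;
* `thmA2Emb_of_submanifold : ThmA2Emb n t M` (Theorem A.2, embedded reading), `thmA1EmbAt_of_submanifold` (Theorem A.1,
  small-data clause) and `thmA1EmbAt_of_submanifold_of_large` (reduction to the large-data clause),
  `geomConstruction4_of_submanifold` (Construction 4).

The empty target (`M = ∅`, allowed by the predicates) is treated separately: all statements are then vacuous.  No
`Prop`-valued definition, no named fact; axioms standard.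
-/

namespace Literature.MathematicalPhysics.QuantumFieldTheory.Federbush1986

noncomputable section

open Metric Set Filter Function
open scoped ContDiff Topology NNReal

namespace PhaseCellIVAppA

open Literature.AlgebraicGeometry.RealAlgebraic Literature.Analysis.Calculus

variable {t d : ℕ}

/-! ## §1 Theorems A.3 and A.4 (decls of record) for every compact `C^∞` submanifold -/

/-- **Theorem A.3 of [Federbush1988PhaseCellIV] for every compact `C^∞` submanifold `M ⊂ R^t`** (decl of record
`ThmA3ContCap`, the p. 339 «Caution» cap): for every cap `c₁` there are constants `c_m` such that every `f : B → M` with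
`Λ₁(f) ≤ c₁` has `f^s : B → M`, `= f` on `∂B`, continuous on `B`, `C^∞` inside, `‖D^m f^s(x)‖ ≤ c_m d(x,∂B)^{−(m−1)} Λ₁(f)`.
Hypotheses: `M` compact and a `d`-dimensional embedded `C^∞` submanifold (read in coordinates); the normal projection `Pr_M`
of (A.31) is the smooth nearest-point retraction `exists_smooth_retraction_euclidean`.
[cite: Federbush1988PhaseCellIV, Theorem A.3 (A.25)–(A.26), (A.31) p. 342; «Caution» p. 339] -/
theorem thmA3ContCap_of_submanifold {M : Set (EuclideanSpace ℝ (Fin t))} (hMc : IsCompact M)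
    (hM : IsSubmanifoldOfDim d (EuclideanSpace.equiv (Fin t) ℝ '' M)) (n : ℕ) : ThmA3ContCap n t M := by
  by_cases hne : M.Nonempty
  · obtain ⟨r, hr, P, hP, hPM, hPid, hPb, -⟩ := exists_smooth_retraction_euclidean hMc hne hM
    exact Retract.thmA3ContCap_of_retract hr hP hPM hPid hPb n
  · -- empty target: there is no `f : B → ∅` (the ball contains `0`), the statement is vacuous
    intro c₁
    refine ⟨fun _ => 0, fun f _ => ?_⟩
    exact absurd ⟨_, (f ⟨0, mem_closedBall_self zero_le_one⟩).2⟩ hne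

/-- **Theorem A.4 of [Federbush1988PhaseCellIV] for every compact `C^∞` submanifold `M ⊂ R^t`** (decl of record
`ThmA4ContCap`): for every cap `c₁` there are constants `c_m` such that for every centre `x₀` every Lipschitz `f : ∂B → M` with
`Λ₁(f) ≤ c₁` has `f^{es} : B − x₀ → M`, `= f` on `∂B`, continuous, `C^∞` on the open punctured ball, with
`‖D^m f^{es}(x)‖ ≤ c_m d(x, ∂B ∪ x₀)^{−(m−1)} |x − x₀|^{−1} Λ₁(f)`.
[cite: Federbush1988PhaseCellIV, Theorem A.4 (A.34)–(A.36) p. 343; (A.31) p. 342; «Caution» p. 339] -/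
theorem thmA4ContCap_of_submanifold {M : Set (EuclideanSpace ℝ (Fin t))} (hMc : IsCompact M)
    (hM : IsSubmanifoldOfDim d (EuclideanSpace.equiv (Fin t) ℝ '' M)) (n : ℕ) : ThmA4ContCap n t M := by
  by_cases hne : M.Nonempty
  · obtain ⟨r, hr, P, hP, hPM, hPid, hPb, -⟩ := exists_smooth_retraction_euclidean hMc hne hM
    exact Retract.thmA4ContCap_of_retract hr hP hPM hPid hPb n
  · -- empty target: a datum `f : ∂B → ∅` exists only if `∂B = ∅`, i.e. the source space is the point `{x₀}`, and then
    -- `B − x₀ = ∅`: every clause is vacuous (same bookkeeping as `Retract.thmA4ContCap_sphere` for `t = 0`)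
    intro c₁
    refine ⟨fun _ => 0, fun x₀ f _ => ?_⟩
    have hpt : ∀ y : EuclideanSpace ℝ (Fin n), y = x₀ := by
      intro y
      by_contra hy
      have hy0 : y - x₀ ≠ 0 := sub_ne_zero.2 hy
      have hmem : x₀ + ‖y - x₀‖⁻¹ • (y - x₀) ∈ sphere x₀ 1 := by
        rw [mem_sphere, dist_eq_norm, add_sub_cancel_left, norm_smul, norm_inv, norm_norm,
          inv_mul_cancel₀ (norm_ne_zero_iff.2 hy0)]
      exact hne ⟨_, (f ⟨_, hmem⟩).2⟩
    have hempty : ∀ S : Set (EuclideanSpace ℝ (Fin n)), S \ {x₀} = ∅ := fun S =>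
      eq_empty_of_forall_notMem fun y hy => hy.2 (mem_singleton_iff.2 (hpt y))
    refine ⟨fun _ => 0, ?_, fun x => absurd ⟨_, (f x).2⟩ hne, ?_, ?_, fun m _ K _ _ x hx => ?_⟩
    · rw [hempty]; exact mapsTo_empty _ _
    · rw [hempty]; exact continuousOn_empty _
    · rw [hempty]; exact contDiffOn_empty
    · rw [hempty] at hx; exact absurd hx (notMem_empty _)

/-- **Both rows at once.** [cite: Federbush1988PhaseCellIV, Theorem A.3 p. 342, Theorem A.4 p. 343] -/
theorem thmA3ContCap_and_thmA4ContCap_of_submanifold {M : Set (EuclideanSpace ℝ (Fin t))} (hMc : IsCompact M)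
    (hM : IsSubmanifoldOfDim d (EuclideanSpace.equiv (Fin t) ℝ '' M)) (n : ℕ) :
    ThmA3ContCap n t M ∧ ThmA4ContCap n t M :=
  ⟨thmA3ContCap_of_submanifold hMc hM n, thmA4ContCap_of_submanifold hMc hM n⟩

/-! ## §2 Theorem A.2, Theorem A.1 (small clause), Geometric Construction 4 for every compact `C^∞` submanifold -/

/-- **Theorem A.2 of [Federbush1988PhaseCellIV] (embedded reading `ThmA2Emb`) for every compact `C^∞` submanifold
`M ⊂ R^t`** — the Lipschitz neighbourhood retraction that `thmA2Emb_of_retract` takes as hypotheses is the tubular one.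
[cite: Federbush1988PhaseCellIV, Theorem A.2 (A.18)–(A.19) p. 341; p. 342] -/
theorem thmA2Emb_of_submanifold {M : Set (EuclideanSpace ℝ (Fin t))} (hMc : IsCompact M)
    (hM : IsSubmanifoldOfDim d (EuclideanSpace.equiv (Fin t) ℝ '' M)) (n : ℕ) : ThmA2Emb n t M := by
  by_cases hne : M.Nonempty
  · obtain ⟨r, hr, P, -, hPM, hPid, -, L, hPL⟩ := exists_smooth_retraction_euclidean hMc hne hM
    exact thmA2Emb_of_retract hr hPL (fun y hy => hPM y hy) hPid n
  · refine ⟨1, one_pos, 1, 1, fun f₁ f₂ f₁e _ _ => ?_⟩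
    exact absurd ⟨_, (f₁e ⟨0, mem_closedBall_self zero_le_one⟩).2⟩ hne

/-- **Theorem A.1 of [Federbush1988PhaseCellIV], small-data clause, for every compact `C^∞` submanifold `M ⊂ R^t`:**
there is a cap `c₁ > 0` for which `ThmA1EmbAt n t M c₁` holds (every null-homotopic `f : ∂D → M` with `Λ₁(f) ≤ c₁` extends to
`D` with `Λ₁(f^e) ≤ c₂ Λ₁(f)`). [cite: Federbush1988PhaseCellIV, Theorem A.1 (A.1)–(A.2) p. 339] -/
theorem thmA1EmbAt_of_submanifold {M : Set (EuclideanSpace ℝ (Fin t))} (hMc : IsCompact M)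
    (hM : IsSubmanifoldOfDim d (EuclideanSpace.equiv (Fin t) ℝ '' M)) (n : ℕ) :
    ∃ c₁ : ℝ≥0, 0 < c₁ ∧ ThmA1EmbAt n t M c₁ := by
  by_cases hne : M.Nonempty
  · obtain ⟨r, hr, P, -, hPM, hPid, -, L, hPL⟩ := exists_smooth_retraction_euclidean hMc hne hM
    exact thmA1EmbAt_of_retract hr hPL (fun y hy => hPM y hy) hPid n
  · refine ⟨1, one_pos, 0, fun f hf _ => ?_⟩
    obtain ⟨y, -⟩ := hf
    exact absurd ⟨_, y.2⟩ hne

/-- **Theorem A.1, reduction to the large-data clause, for every compact `C^∞` submanifold** (the form of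
`thmA1EmbAt_of_retract_of_large` with the retraction hypotheses discharged): if for the cap `ε` every null-homotopic
`f : ∂D → M` with `ε ≤ Λ₁(f) ≤ c₁` extends with `Λ₁(f^e) ≤ c_l`, then `ThmA1EmbAt n t M c₁`.
[cite: Federbush1988PhaseCellIV, Theorem A.1 p. 339, (A.9)–(A.10) p. 340] -/
theorem thmA1EmbAt_of_submanifold_of_large {M : Set (EuclideanSpace ℝ (Fin t))} (hMc : IsCompact M)
    (hM : IsSubmanifoldOfDim d (EuclideanSpace.equiv (Fin t) ℝ '' M)) (n : ℕ) :
    ∃ ε : ℝ≥0, 0 < ε ∧ ∀ c₁ cl : ℝ≥0,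
      (∀ f : C(↥(cubeBoundary n), ↥M), f.Nullhomotopic → (ε : ENNReal) ≤ lipConst f → lipConst f ≤ c₁ →
        ∃ fe : ↥(unitCube n) → ↥M, (∀ x : ↥(cubeBoundary n), fe ⟨x.1, cubeBoundary_subset n x.2⟩ = f x) ∧
          lipConst fe ≤ cl) →
      ThmA1EmbAt n t M c₁ := by
  by_cases hne : M.Nonempty
  · obtain ⟨r, hr, P, -, hPM, hPid, -, L, hPL⟩ := exists_smooth_retraction_euclidean hMc hne hM
    exact thmA1EmbAt_of_retract_of_large hr hPL (fun y hy => hPM y hy) hPid n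
  · refine ⟨1, one_pos, fun c₁ cl _ => ⟨0, fun f hf _ => ?_⟩⟩
    obtain ⟨y, -⟩ := hf
    exact absurd ⟨_, y.2⟩ hne

/-- **Geometric Construction 4 of [Federbush1988PhaseCellIV] §11 p. 338 for every compact `C^∞` submanifold `M ⊂ R^t`.**
[cite: Federbush1988PhaseCellIV, Geometric Construction 4 p. 338] -/
theorem geomConstruction4_of_submanifold {M : Set (EuclideanSpace ℝ (Fin t))} (hMc : IsCompact M)
    (hM : IsSubmanifoldOfDim d (EuclideanSpace.equiv (Fin t) ℝ '' M)) (k : ℕ) : GeomConstruction4 k t M :=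
  geomConstruction4_of_thmA2Emb (thmA2Emb_of_submanifold hMc hM k)

end PhaseCellIVAppA

end

end Literature.MathematicalPhysics.QuantumFieldTheory.Federbush1986
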